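import Mathlib
import HarnessLib
import HarnessLib.Audit
import Summits.FinalStateConjecture.Statement
import Literature.Geometry.Lorentzian.NearKerrLeaf
import Literature.Geometry.Lorentzian.CutBondiMass
import Summits.FinalStateConjecture.FinalStateConjecture.Theorems.BartnikGapSettlingSelfCompetitor
import HarnessLib.Audit.Status.Attr

/-!
Route: BartnikGapSettling

# Route BartnikGapSettling — settled means it cannot lose weight — the Bondi–Bartnik gap of late
horizon collars as a one-slice settling functional, Kerr its unique minimiser

It suffices to show X = BondiBartnikRigidity ∧ GapExhaustion ∧ SettledCapture ∧
TameCensorshipCollarMargin ∧ MGHDExists (five cruxes;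
proved support: SelfCompetitor), realising card settled-means-cannot-lose-weight-bartnik. The seam
is ONE SCALAR ON ONE SLICE. For a late CORE
C = {probe point p} ∪ (THICK horizon collars {t* = 0, Mᵢ < rᵢ ≤ 3Mᵢ} of N Kerr-star charts δ-close
to Kerr) the BONDI–BARTNIK GAP of C is
(Bondi energy of the cut of 𝓘⁺ generated by C, i.e. a Hawking-mass limit along receding round
sections of ∂J⁺(C), `HasCutBondiMass`) minus
(the infimum of the same quantity over all COMPETITORS: maximal vacuum Cauchy developments of
ADMISSIBLE data receiving an isometric,
time-oriented open embedding of an open neighbourhood of C) — Bartnik's quasi-local mass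
(Bartnik1989, HuangLee2020 Def. 7.8) with the
Bondi mass of the core's own cut in place of the ADM mass; the no-horizon condition is automatic (a
core hidden behind a competitor's
horizon generates no receding round sections). GapExhaustion (card K2+K4, the dynamical input): in
every complete-𝓘⁺ MGHD whose late
near-Kerr collars obey a sub-extremality margin, beyond every compact set there are bounded-geometry
hyperboloidal leaves (IsNearKerrLeaf
with a LARGE tolerance Λ) through δ-near-Kerr thick collars whose core has gap ≤ γ — for every δ, γ
> 0, with N ≤ N₀ holes of masses in
[m₀, 1/m₀]. BondiBartnikRigidity (card K1+K3, the engine, rate-free and teleology-free):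
C^{k'}-bounded geometry + δ-near-Kerr thick
collars + gap ≤ γ ⇒ an (ε,k)-near-Kerr leaf in the causal future of the slice — "a slice that cannot
lose weight with its collars held
fixed is a slice of Kerr", quantitatively, by interpolation between the weak quantity (mass) and the
strong norm (C^{k'}). SettledCapture is the
leaf-capture crux RE-TYPED for the T2 summit statement (p126844, 2026-08-16): the hypotheses of the
sibling crux Capture
(stmt-FinalStateConjecture-10115, route QuietWindowCapture) verbatim, the conclusion the re-typed
settled clause verbatim — sub-extremal
holes, O = exteriorOf d.charted, RaysStayInClosure 𝒟 O (intrinsic lower bound on the settled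
region), HasExhaustiveCharts d (honest
near-zone radii R ≥ max(r₊,0)+1, R → ∞) and IsFutureOriented d (orthochronous motions, transported
Kerr timeVector push-forwards
eventually future-directed); TameCensorshipCollarMargin is weak
cosmic censorship + the generic third law in near-horizon (collar) form, ONE TAME-generic statement
(IsTameChristodoulouGeneric on one fixed end, as the re-typed summit demands); MGHDExists is the
shared anti-vacuity
crux (stmt-FinalStateConjecture-9937; known in print, CBG 1969 Thm 3, unproved in the tree,
re-badged crux 2026-08-16 for the crux-only deciding theorem); SelfCompetitor (provable now)
certifies that the development competes for its own cores, so the gap is ≥ 0 and the gap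
hypothesis is never vacuous.
Lean: `BondiBartnikRigidity ∧ GapExhaustion ∧ SettledCapture ∧ TameCensorshipCollarMargin ∧
MGHDExists`

## Assembly
A few lines of logic, sorry-free in Sketch.lean and shipped as glue.lean (theorem `closes`, axioms
propext / Classical.choice / Quot.sound
only; re-elaborated 2026-08-16 against the T2 statement; CRUX-ONLY since rev 5: its five binders are
exactly the five crux items): TAME Christodoulou codimension is monotone under pointwise implication
on the
admissible class (same end, same tame immersed injective family, weaker escape clause), so it
suffices that the generic property
of TameCensorshipCollarMargin implies the Statement's property datum by datum; MGHDExists gives the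
MGHD; for an MGHD 𝒟 the generic
property gives complete 𝓘⁺ and the collar margin; GapExhaustion (fed the margin) gives N₀, m₀, χ
and, for the k′ that
BondiBartnikRigidity requests for (χ, m₀, N₀, k, ε), a geometry bound Λ; BondiBartnikRigidity
returns (δ, γ); GapExhaustion at (k′, Λ, δ, γ, K)
returns a late bounded-geometry leaf S with δ-collars and gap ≤ γ; BondiBartnikRigidity turns it
into an (ε,k)-near-Kerr leaf S′ ⊆ J⁺(S),
still disjoint from J⁻(K) (Disjoint.mono_left), whose parameters carry the margin always — which is
SettledCapture's hypothesis (its inlined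
leaf block is definitionally `IsNearKerrLeaf`), and SettledCapture yields the sub-extremal,
ray-closed, exhaustive, future-oriented C²
decomposition. The proved support SelfCompetitor is not a binder. (The pre-re-type Assembly item
stmt-FinalStateConjecture-10811 and its proof
`BartnikGapSettling.assembly_proof` decided the OLD statement and are dropped from the route:
`closes` is the deciding theorem, D-0027.)

Rationale: WHY THIS LINE. Bartnik's variational picture (Bartnik1989; Bartnik2002ICM Def. 4, Thm 6 and the
"space-time generalisation … the exterior metric is
stationary") makes STATIONARITY the Euler–Lagrange equation of MASS: a region that is not stationary
admits a mass-decreasing competitor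
(Corvino2000; AndersonJauregui2019 and HuangLee2020 Thm 9 for the static case; HuangLee2020 Thm 10:
DEC minimisers carry a global Killing
field, vacuum on the domain of dependence of the vacuum region; An2018Ellipticity /
An2020MassMinimizing: the stationary vacuum Bartnik
boundary problem is elliptic). The final state conjecture says the Einstein flow eventually performs
every rearrangement it can: with the
Bondi mass of the core's own cut in place of ADM, "settled" becomes "Bondi mass = Bartnik mass of
the collars", a gauge-free scalar on one
slice, and the Liouville step "eternally non-radiating ⇒ stationary ⇒ Kerr" of every ω-limit route
is replaced by ONE-SLICE quantitative
rigidity whose empty-core case is the stability of the positive mass theorem (DongSong2024) and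
whose exact case at a Kerr collar is a
Bartnik-form no-hair theorem. Imported areas: the calculus of variations / quasi-local mass theory
of Riemannian geometry (Bartnik,
Corvino, Huang–Lee, An, Mantoulidis–Schoen), quantitative rigidity of the positive mass theorem
(Dong–Song, level-set methods), and
black-hole thermodynamics only through the sign of the second variation (HollandsWald2012: the
canonical energy can be negative for
non-axisymmetric perturbations in the ergoregion — whence THICK collars {r ≤ 3M} ⊇ ergoregion, which
also contain an open strictly
stationary shell so that a stationary extension agreeing with Kerr there is Kerr by
analyticity/unique continuation, AlexakisIonescuKlainerman2009).
No route of this summit uses a quasi-local mass infimum as its rigidity engine (40 Theses files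
grepped: Bartnik appears only as
ADM-mass/constraint background); the sibling QuietWindowCapture's abstract rank-2 crux QuietLeaves
("budget ⇒ quiet ⇒ near-Kerr
leaves") is here DECOMPOSED into GapExhaustion + BondiBartnikRigidity with a concrete hypothesis
object; its Capture crux was shared verbatim
until the summit re-type of 2026-08-16 (T2, p126844), after which this route carries the re-typed
SettledCapture (Capture's hypotheses, the T2 conclusion).

RANKED CRUXES. #2 BondiBartnikRigidity (crux) — QUANTITATIVE BONDI–BARTNIK RIGIDITY AT KERR COLLARS
(card K1+K3). For every margin χ < 1, mass window m₀, hole bound N₀, target (k, ε): there is k' such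
that for every geometry bound Λ < ∞ there are δ, γ > 0 with: whenever an MGHD 𝒟 of admissible vacuum
data contains a hypersurface S which is a (Λ, k')-near-Kerr leaf with N ≤ N₀ holes (Mᵢ, aᵢ), m₀ ≤ Mᵢ
≤ 1/m₀, |aᵢ| ≤ χMᵢ (bounded geometry, not smallness), a point p ∈ S, and N pairwise disjoint thick
collar charts Φᵢ (Kerr-star charts on {Mᵢ < r ≤ 3Mᵢ} × (−1,1), smooth open embeddings, δ-close in
C^{k'} to Kerr(Mᵢ,aᵢ) on the collar slab, collar slabs ⊆ S) such that the core C = {p} ∪ ⋃ collars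
has a cut Bondi energy and Bondi–Bartnik gap ≤ γ — then some (ε, k)-near-Kerr leaf S′ with the same
(N, M, a) lies in J⁺(S). Exact case (δ = γ = 0, N = 1): a slice realising the Bondi–Bartnik infimum
of its own Kerr collar is a slice of Kerr (minimiser ⇒ stationary vacuum ⇒ equal to Kerr on the
strictly stationary shell ⇒ Kerr); N = 0: small Bondi mass at the cut of a point + bounded geometry
⇒ near-flat hyperboloid (positive-mass stability at 𝓘⁺); N ≥ 2: no stationary competitor exists, the
gap measures binding energy and closes only by separation. [difficulty: open-problem] (why it might
fail: Rotating case rests on 'Kerr is Bondi–Bartnik-minimal rel. its thick collar' (δ²M_B =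
canonical energy, sign unknown off axisymmetry, HollandsWald2012 p.6): a cheaper vacuum extension of
a Kerr collar (a≠0) makes settled Kerr have gap>0; N≥2 binding term.) [HuangLee2020, Bartnik2002ICM,
Corvino2000, AndersonJauregui2019, An2018Ellipticity, An2020MassMinimizing, MantoulidisSchoen2015,
HollandsWald2012, DongSong2024, AlexakisIonescuKlainerman2009, arXiv:2302.07414]
#3 GapExhaustion (crux) — GAP EXHAUSTION (card K2+K4, the dynamical input). For every admissible
datum and every MGHD 𝒟 with complete 𝓘⁺ (sojourn form) satisfying the COLLAR MARGIN (some χ₁ < 1,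
k₁, δ₁ > 0, compact K₁: every thick collar chart δ₁-close in C^{k₁} to Kerr(M₁,a₁) lying beyond
J⁻(K₁) has |a₁| ≤ χ₁M₁): there are N₀, m₀ > 0, χ < 1 such that for every k there is Λ < ∞ such that
for every δ, γ > 0 and every compact K, 𝒟 contains a (Λ,k)-near-Kerr leaf S with J⁺(S) ∩ J⁻(K) = ∅,
N ≤ N₀ holes with m₀ ≤ Mᵢ ≤ 1/m₀, |aᵢ| ≤ χMᵢ, a point p ∈ S and N pairwise disjoint thick collar
charts δ-close in Cᵏ to Kerr(Mᵢ,aᵢ) with collar slabs ⊆ S, such that the core {p} ∪ ⋃ collars has a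
cut Bondi energy and Bondi–Bartnik gap ≤ γ. In words: late hyperboloidal slices have uniformly
bounded geometry, finitely many non-tiny apparent horizons with near-Kerr thick collars, and ALL the
Bondi mass is eventually attributable to the collars — nothing outside them could still be shed
(radiation leaves, holes separate, no eternal reservoir). [difficulty: open-problem] (why it might
fail: ∀-data given complete scri+: an eternal exterior reservoir (vacuum breather, bound companion
never merging) keeps gap ≥ γ₀>0; Λ-bounded late hyperboloids fail under a high-frequency cascade
(Burnett regime); Bondi mass at late cuts needs regular scri.) [ChruscielJezierskiLeski2004,
ChristodoulouKlainerman1993PMS41, HuangLee2020, DafermosRodnianski2008,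
KehrbergerLogarithmicAsymptotics, arXiv:1504.04592, arXiv:0811.0354]
#4 SettledCapture (crux) — SETTLED CAPTURE (re-typed T2 form of the sibling crux Capture,
stmt-FinalStateConjecture-10115; hypotheses verbatim, conclusion = the re-typed summit clause
verbatim): an MGHD of an admissible datum with complete 𝓘⁺ whose (ε,k)-near-Kerr leaves exist beyond
every compact set for every tolerance, with N ≤ N₀ holes of masses in [m₀, 1/m₀], and which carry a
margin |aᵢ| ≤ χMᵢ once fine enough, settles down EXACTLY as the T2 Statement demands: a C²
FinalStateDecomposition d on O = J⁺(ιX) ∩ I⁻(charts) with sub-extremal holes, RaysStayInClosure 𝒟 O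
(every future-complete normalised null ray from Σ stays in closure O — the witness does not choose
where the conclusion is inspected), HasExhaustiveCharts d with HONEST radii (Rᵢ(τ) ≥ max(r₊,0)+1, Rᵢ
→ ∞, near-zone C² convergence out to Rᵢ, every point of O outside the certified late region causally
below the certified slab) and IsFutureOriented d (orthochronous Λᵢ; push-forwards of the transported
Kerr timeVector on truncated slabs and of ∂₀ on flat slabs eventually future-directed). Sub-extremal
Kerr stability fed with interior hyperboloidal data (N ≤ 1), multi-Kerr capture (N ≥ 2); the
orientation sign is pinned by the leaves (W ⊆ I⁺(S) in the leaf block), the radii by the near zones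
of the stability theorems; the rays clause is the genuinely new obligation. [deps:
BondiBartnikRigidity, GapExhaustion] [difficulty: open-problem] (why it might fail: quiet ≠ settled
for N ≥ 2 (no velocities: bound binaries, late plunges); unweighted Cᵏ leaves vs weighted decay;
only |a| ≪ M known; RaysStayInClosure is interior content — no future-complete null ray from Σ
inside the black hole — which exterior leaves do not control (near Kerr: Dafermos–Luk C⁰-stability
of the Cauchy horizon; dynamical N ≥ 2 interiors unknown).) [KlainermanSzeftel2023,
DafermosHolzegelRodnianskiTaylor2021, DafermosRodnianski2008, arXiv:2205.14808, arXiv:2104.11857,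
arXiv:1710.01722]
#5 TameCensorshipCollarMargin (crux) — TAME GENERIC CENSORSHIP + COLLAR MARGIN, ONE generic
statement in the re-typed genericity (IsTameChristodoulouGeneric … 1: through every exceptional
admissible datum an injective one-parameter family of admissible data, tame on ONE fixed end —
jointly smooth, continuous mass, wDist-continuous at 0 — and immersed at 0, all other members good;
tame genericity is not closed under ∧ either, hence one statement): for every connected Hausdorff
second-countable 3-manifold X, tame-generically in the admissible class, EVERY MGHD of the datum has
complete future null infinity (sojourn form) AND the collar margin of GapExhaustion (late thick
near-Kerr collars are uniformly sub-extremal: |a₁| ≤ χ₁M₁ with χ₁ < 1) — weak cosmic censorship in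
the audited T2 typing plus the generic third law of black-hole mechanics in near-horizon form. It
carries no settling claim; it replaces the pre-re-type GenericCensorshipCollarMargin (same property,
topology-free IsChristodoulouGeneric), which the T2 summit no longer accepts. [difficulty:
open-problem] (why it might fail: contains weak cosmic censorship outright; extremal horizons form
on the collapse threshold (Kehle–Unger), so the margin is at best generic; TAME witness families
(fixed end, wDist → 0, immersed) must now be produced through every exceptional datum — even their
bare non-vacuity rests on two unproved in-tree lemmas (MissingL3/L4 of the re-type report).)
[Christodoulou1999, KehleUnger2025, arXiv:2402.10190, Aretakis2015, arXiv:1710.01722,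
arXiv:0811.0354]
#9 MGHDExists (crux; re-badged support→crux 2026-08-16 for the CRUX-ONLY deciding theorem, whose
fifth binder it is) — every admissible datum has a maximal vacuum Cauchy development over the
repaired structure (Choquet-Bruhat–Geroch 1969 Thm 3, Sbierski 2016 Thm 2.6) — the anti-vacuity
conjunct of the Statement; filed with the verbatim signature of the sibling routes' shared item
(stmt-FinalStateConjecture-9937) so that it deduplicates onto it. [difficulty: XL] (why it might
fail: known in print but an unproved XL tree fact, choquetBruhat_geroch_exists_mghd_cauchy, typed
over the REPAIRED prelude — IsMaximal asks every typed VacuumCauchyDevelopment of D to embed into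
one 𝒟; a rogue typed development falsifies it, as the first rendering, VacuumDevelopment.isEmpty,
was refuted.) [ChoquetBruhatGeroch1969CMP, Ringstrom2009, Sbierski2016AHP]
#9 SelfCompetitor (support) — ANTI-VACUITY OF THE COMPETITOR CLASS (provable now; proved in the
planner's sk/IffCheck.lean as `selfCompetitor_holds` with U = univ, φ = id): for every vacuum Cauchy
development 𝒟, core C and real m with HasCutBondiMass 𝒟 C m, the identity is an admissible
competitor embedding — an open U ⊇ C and φ smooth on U, an open embedding of U, isometric and
future-directed on U, with HasCutBondiMass 𝒟 (φ '' C) m. Hence the development competes for its own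
cores whenever the cut has a Bondi energy: the Bondi–Bartnik gap is ≥ 0 and the gap clause of the
cruxes has content. [difficulty: provable-now] [Bartnik1989, ChristodoulouKlainerman1993PMS41]

TWO-LAYER PLAN. Foreseen glued splits (none filed now; k ≤ 3, depth 1). BondiBartnikRigidity ⇐
NearMinimiserNearStationary (gap ≤ γ + bounded geometry ⇒
the slice outside the collars is ω(γ)-close, first in a mass-controlled weak norm (Dong–Song /
level-set coercivity transplanted to the
Bondi mass of the cut), then in Cᵏ by interpolation against Λ, to a STATIONARY vacuum extension of
the collars: the quantitative form of
HuangLee2020 Thm 10 / An2020MassMinimizing) → StationaryExtensionOfKerrCollarIsKerr (a stationary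
vacuum extension agreeing with Kerr on the
strictly stationary shell 2M < r ≤ 3M is Kerr on the connected exterior: analyticity + unique
continuation, AlexakisIonescuKlainerman2009;
its linearisation is An2018Ellipticity at Kerr thick-collar data) → KerrCollarMinimal (β_B(thick
Kerr collar) = M: second variation of
the cut Bondi mass under vacuum perturbations supported in {r ≥ 3M} is ≥ 0, the HollandsWald2012
canonical energy with δA = δJ_H = 0) →
BondiBartnikRigidity. GapExhaustion ⇐ LateBoundedLeaves (complete 𝓘⁺ ⇒ Λ-bounded late hyperboloidal
leaves with N ≤ N₀ non-tiny
near-Kerr thick collars: the horizon budgets, area law + red-shift, give collar convergence) →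
GapTendsToZero (Bondi mass loss + "β_B is
non-increasing along domain-of-dependence-nested cores and tends to M_∞": the no-parking content) →
GapExhaustion. TameCensorshipCollarMargin
⇐ CensorshipCurves → ThirdLawCollarCurves → joint transversality (now with TAME curves on the fixed
end), as in the sibling routes. SettledCapture ⇐ ExteriorCapture (sub-extremal holes, O =
exteriorOf, HasExhaustiveCharts, IsFutureOriented: the stability theorems' output) →
InteriorRaysIncomplete (given the settled exterior (O, d): RaysStayInClosure 𝒟 O, i.e. no
future-complete null ray from Σ inside the hole; to be typed with a refuter so that no
perverse-but-valid (O, d) makes the universal form false) → SettledCapture. When the definition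
requests land, tenure
restates the two new cruxes over `BondiBartnikGapLE` / `NearKerrCollarCore` / `CollarMargin`
(readable forms with Iff.rfl proofs in the
planner folder, sk/IffCheck.lean).

KILL CRITERIA. refuted:BondiBartnikRigidity by a vacuum extension of an exact thick Kerr collar (a ≠
0, |a| ≤ χM) with cut Bondi mass < M — equivalently a
negative direction of the second variation of M_B at Kerr among perturbations supported in {r ≥ 3M}
— kills the functional as calibrated:
pivot ONCE by restating both new cruxes with the gap measured against β_B(Kerr collar of the same
(M,a)) instead of the infimum (file
KerrCollarMinimal's negation as negative knowledge); if the cheaper extension is moreover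
non-stationary-compatible (a Mantoulidis–Schoen
phenomenon for THICK collars: infimum not attained by any stationary extension), close
`refuted:BondiBartnikRigidity` — the line is dead.
refuted:GapExhaustion by an admissible complete-𝓘⁺ MGHD with an eternal exterior reservoir (gap ≥ γ₀
> 0 forever: vacuum breather, geon,
never-merging bound companion) or with unbounded late curvature on every hyperboloidal foliation
closes the route and hands the witness to
cards lasalle-bondi-lyapunov-liouville / no-soft-geons as negative knowledge. MGHDExists is shared
and SettledCapture is the T2 form every leaf-capture route needs: their refutation breaks
every leaf-capture route at once. refuted:SettledCapture through the RAYS clause alone (a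
development with near-Kerr leaves and a future-complete null ray trapped inside the hole) ⇒ split as
in the two-layer plan and keep ExteriorCapture; through the capture content ⇒ as for Capture
(sibling tenure). TameCensorshipCollarMargin refuted through an OPEN set of admissible
data with incomplete 𝓘⁺ or extremal late collars is ¬FinalStateConjecture as typed. Mooted
(superseded) if QuietLeaves
(stmt-FinalStateConjecture-10114) is proved directly — then GapExhaustion ∧ BondiBartnikRigidity is
bypassed.

NOT DECOMPOSED YET. Deliberately layer-2: the weak-norm form of rigidity (which mass-controlled
distance — intrinsic flat, pointed measured GH after excising
bubbles, W^{1,p} of the data — the Bondi–Bartnik gap is coercive for); the vacuum small-neck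
dichotomy "a bubble is a hole or nothing"
(needed inside NearMinimiserNearStationary; shared with card pmt-almost-rigidity-bubbles-are-holes);
existence of admissible one-ended
competitors realising β_B near Kerr (interior caps of Kerr exterior data by gluing,
CzimekRodnianski2022 / Corvino–Schoen); monotonicity of
β_B along domain-of-dependence-nested cores and the Bondi mass-loss law over `CauchyDevelopment`
(printed only for Bondi–Sachs / CK
spacetimes, see the CutBondiMass docstring); the N ≥ 2 kinematics (gap ≈ binding energy M₁M₂/D +
exterior radiation); the N = 0 branch as
the probe-point case (gap({p}) = Bondi mass of the cone of p, β_B({p}) = 0); horizon-normalised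
charts behind Capture. None of these is an
item at open (D-0019): they are children of the two new cruxes or prover-attached lemmas.

CHEAPEST FALSIFIER. Second variation at Kerr, a finite computation in black-hole perturbation
theory: for linearised vacuum perturbations of sub-extremal Kerr
(start with a/M = 0.5, 0.9) supported at one time in {r ≥ 3M} (so δA = δJ_H = 0 and the thick collar
is untouched), is the Hollands–Wald
canonical energy ℰ = δ²M_Bondi(cut) ever NEGATIVE for a non-axisymmetric mode (m ≠ 0, frequency in
the superradiant window 0 < ω < mΩ_H)?
HollandsWald2012 (p. 6) expect ℰ < 0 for perturbations reaching the ergoregion; the bet is that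
support outside {r ≤ 3M} ⊋ ergoregion makes
ℰ ≥ 0. A negative value refutes KerrCollarMinimal, hence GapExhaustion as calibrated (settled Kerr
would keep gap > 0) — run it before
staffing provers. Lookup half (done, 2026-08-15): no printed vacuum extension of a Kerr region with
smaller mass; for a = 0 and
time-symmetric slices β = M is a theorem (Huisken–Ilmanen via Bartnik2002ICM p. 5: boundaries
embedding in Schwarzschild and enclosing the
horizon have m̃_QL = m). Not run here (no kit in plancard mode).

NUMBERS. Static/stationary minimiser theorems: time-symmetric minimisers are static vacuum
(Corvino2000; AndersonJauregui2019; HuangLee2020 Thm 9);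
DEC minimisers, 3 ≤ n ≤ 7, (g,π) ∈ C⁵×C⁴: global Killing field, vacuum on D(vacuum region), null
dust elsewhere (HuangLee2020 Thm 10);
counterexamples to Bartnik's stationary and strict-positivity conjectures only for n > 8 (pp-waves,
HuangLee2020 Ex. 2.5). Degeneration:
Bartnik mass of a bare apparent horizon = √(A/16π), approached by non-stationary necks
(MantoulidisSchoen2015) — excluded here by thick
collars with fixed interior geometry. Positive-mass stability: m_ADM → 0 ⇒ pmGH convergence to ℝ³
after excising sets of boundary area → 0
(DongSong2024). Kerr thick collar: ergosurface r_E(θ) = M + √(M² − a²cos²θ) ≤ 2M < 3M; r₊ = M + √(M²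
− a²) ≥ M(1 + √(1−χ²)) under the
margin; the star chart domain is {r > M}. Canonical energy: ℰ = δ²M − Σ Ω δ²J − (κ/8π) δ²A for
axisymmetric perturbations (HollandsWald2012
eq. p. 13); sign-indefinite off axisymmetry. Perturbative capture: |a|/M ≪ 1 (KlainermanSzeftel2023,
arXiv:2205.14808), Schwarzschild
codimension 3 (DafermosHolzegelRodnianskiTaylor2021). Items at open: 7 (4 cruxes, 2 supports, 1
assembly); after the T2 repair (2026-08-16): 6 (4 cruxes, 2 supports; Assembly dropped, `closes`
decides); after the crux-only repair (rev 5, 2026-08-16): 7 (5 cruxes incl. MGHDExists, 1 proved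
support SelfCompetitor, 1 assembly = the type of `closes`); longest signature 3311 chars
(SettledCapture = Capture's 3190-char hypotheses + the 5-conjunct T2 conclusion); GapExhaustion 3211
chars.

DEFINITION REQUESTS. Filed right after open, attached to the two new cruxes (readable forms +
Iff.rfl agreement with the filed inlinings are in the planner
folder, sk/IffCheck.lean): (D1) notion `BondiBartnikGapLE 𝒟 C γ` with `IsCompetitorMass 𝒟 C m′`
(topic Literature/Geometry/Lorentzian, next to
CutBondiMass): competitor = MGHD of admissible vacuum data + open U ⊇ C + φ smooth open embedding on
U, isometric (pullbackBilin φ g′ = g on U)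
and future-directed on U, mass = HasCutBondiMass 𝒟′ (φ″C) m′; GapLE = ∀ competitor m′ ∀ η > 0 ∃
actual cut energy m ≤ m′ + γ + η; with the
provable API: SelfCompetitor, gap monotone in γ, GapLE C 0 for exact minimisers. (D2) notion
`NearKerrCollarCore 𝒟 k δ γ N M a S p mo B Φ`
(topic Summits/FinalStateConjecture/FinalStateConjecture/Theorems): the thick-collar chart block of
both cruxes. (D3) notion `CollarMargin 𝒟`
(same topic): the near-horizon third-law clause shared by GapExhaustion (hypothesis) and
TameCensorshipCollarMargin (conclusion). Cite
facts wanted (family gr): HuangLee2020 Thm 10 (Bartnik minimisers carry a Killing field) and Thm 9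
(static case) as named facts over
`InitialDataSet` with boundary data; Bondi mass loss between causally ordered cuts and positivity of
`cutBondiMass` over `CauchyDevelopment`
with complete 𝓘⁺ (SchoenYau1982, LudvigsenVickers1982; ChruscielJezierskiLeski2004 for the
hyperboloidal identification).

Novelty: Searches (2026-08-15, this session; local searchd rc 75 at first, zbMATH 0-hit on two phrasings):
`lit search --source crossref "Bartnik
quasi-local mass stationary conjecture minimizers"` (15: Anderson surveys
doi:10.4310/bpam.2024.v1.n2.a1, doi:10.4310/pamq.2019.v15.n3.a4,
AndersonJauregui2019, Jauregui 2019, WangJinzhao2020 "outer entropy = Bartnik–Bray inner mass" — the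
only SPACETIME sup/inf-over-extensions
functional found, dual (inner) and holographic, no dynamics); `… "Bartnik Bray inner mass outer
entropy spacetime quasi-local infimum"` (10:
+ Wiygul doi:10.1007/s00220-017-3005-8, Jezierski–Smołka quasi-local mass on Kerr spheres
doi:10.1016/j.aop.2024.169905); `lit search
--source arxiv "An ellipticity Bartnik boundary stationary vacuum"` (1: arXiv:1807.00372); `lit
search --source zbmath "Bartnik mass minimizing
extension stationary vacuum Killing initial data"` (0); `lit galaxy search "Bartnik quasi-local
mass" --star all` (3: An–Huang static
extensions arXiv:2103.15887, Carlotto–Li corners arXiv:2308.05409, Ashtekar–Berger centennial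
volume); `lit galaxy search "quasi-local mass
Bondi" --star all` (0); `--star pdf "mass minimizing stationary"` (0); `lit frontier
FinalStateConjecture --since 2020` (21 rows: trapped-surface
formation, multi-black-hole data arXiv:2601.01517, Kerr–de Sitter stability — none
variational/quasi-local); `lit bridges FinalStateConjecture
--cross any` (surveys only); read HuangLee2020 pp. 5–6, 28–31, Bartnik2002ICM pp. 5–6,
HollandsWald201  [refs: 10.4310/bpam.2024.v1.n2.a1, 10.4310/pamq.2019.v15.n3.a4, 10.1007/s00220-017-3005-8, 10.1016/j.aop.2024.169905, 1807.00372, 2103.15887, 2308.05409, 2601.01517, 1802.03331, doi:10.4310/bpam.2024.v1.n2.a1, doi:10.4310/pamq.2019.v15.n3.a4, doi:10.1007/s00220-017-3005-8, doi:10.1016/j.aop.2024.169905, AndersonJauregui2019, WangJinzhao2020, HuangLee2020, HollandsWald2012, DongSong2024]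

Barriers (technique_class: variational-rigidity, quasi-local-mass, kerr-capture): - technique_class: variational-rigidity, quasi-local-mass, kerr-capture
- Literature.Barriers.FinalStateConjecture.IonescuKlainermanNonExtension: evaded — no Killing field
is extended across a horizon from local data; stationarity of the comparison extension is the
Euler–Lagrange equation of a GLOBAL variational problem (infimum over all admissible extensions),
exactly the global input the barrier says is necessary, and the Kerr identification uses the
strictly stationary open shell 2M < r ≤ 3M inside the thick collar (analytic regime), not the
horizon.
- Literature.Barriers.FinalStateConjecture.KerrSuperradiance: conceded as the live danger and
designed around — the only energies are the Bondi mass (monotone, ≥ 0) and an infimum of Bondi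
masses; the ergoregion, where the canonical energy is indefinite (HollandsWald2012 p. 6), is INSIDE
the fixed thick collar {r ≤ 3M}, so competitors cannot exploit negative-energy rearrangements there;
whether support outside 3M suffices is the cheapest falsifier. No globally timelike Killing
combination is used (the file's `KerrNoTimelikeKillingCombination`): HuangLee2020's stationarity is
'Killing, uniformly timelike outside a bounded set', which Kerr satisfies.
- Literature.Barriers.FinalStateConjecture.KerrSuperradianceNarrow: same — no conserved Killing
energy appears in any item; the only monotone quantity is the Bondi mass.
- Literature.Barriers.FinalStateConjecture.PriceLawTail: evaded — the scheme is rate-free (gap → 0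
and ε-leaves,

History (route lifecycle, newest last):
- 2026-08-16T23:15:51Z · rev 3: restated Assembly (stmt-FinalStateConjecture-10811 proved) — route-repair (statement-revised T2, p126844): add SettledCapture (Capture's hypotheses + T2 conclusion: RaysStayInClosure, honest-radii HasExhaustiveCharts, IsF (planner-rrepair-FinalStateConjecture-BartnikGa-b71f091e-0)
- 2026-08-16T23:15:51Z · rev 3: dropped Capture, GenericCensorshipCollarMargin — route-repair (statement-revised T2, p126844): add SettledCapture (Capture's hypotheses + T2 conclusion: RaysStayInClosure, honest-radii HasExhaustiveCharts, IsF (planner-rrepair-FinalStateConjecture-BartnikGa-b71f091e-0)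
- 2026-08-16T23:28:55Z · rev 5: restated Assembly (stmt-FinalStateConjecture-17327) — route-repair (glue.non-crux-hypothesis, cont.): crux-only deciding theorem — closes : BondiBartnikRigidity → GapExhaustion → SettledCapture → TameCensorshipColl (planner-rbadge-FinalStateConjecture-BartnikGap-43114f76-0)
- 2026-08-26T16:13:26Z · DORMANT — reconciler: no traction for 5.7 d (last activity item-proof-filed at 2026-08-20T21:54:35Z); parked, not closed — `ledger route dormant route-FinalStateConjectur (operator:999:300564)
- 2026-08-30T17:05:25Z · REACTIVATED (open) — reconciler: reactivated — activity statement-checked at 2026-08-30T15:54:01Z after parking at 2026-08-26T16:13:26Z (operator:999:377650)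

sub-problem: FinalStateConjecture · status: open · opened planner-plancard-FinalStateConjecture-FinalSt-091519c0-0 2026-08-15T16:24:17Z · rev 6 · ledger route-FinalStateConjecture-BartnikGapSettling
GENERATED by the gate from the ledger (D-0016/17). Provers cite these decls: `theorem foo : Summit.FinalStateConjecture.FinalStateConjecture.Theses.BartnikGapSettling.<Decl> := …` in Summits/FinalStateConjecture/FinalStateConjecture/Theorems/<Name>.lean.
-/

namespace Summit.FinalStateConjecture.FinalStateConjecture.Theses.BartnikGapSettling

open scoped BigOperators Topology Manifold Classical MeasureTheory ProbabilityTheory Matrix InnerProductSpace ComplexConjugate ContinuousMap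
open Filter Set Function TopologicalSpace MeasureTheory

attribute [summit_statement] _root_.FinalStateConjecture

/-- item stmt-FinalStateConjecture-10807 · crux · rank 2 · open · by planner
why it might fail: Needs coercivity mod gauge+(M,a), not just sign, of δ²M_B = Hollands–Wald canonical energy on vacuum perturbations in {r≥3M} (sign unknown off axisymmetry, HW2012 p.6); its exact case presupposes β_B(collar)=M, at a=0 already a null Penrose inequality open beyond arXiv:1506.06400; N≥2 binding.
sources: HollandsWald2012, arXiv:1506.06400, HuangLee2020, Bartnik2002ICM, An2020MassMinimizing, DongSong2024
[crux] QUANTITATIVE BONDI–BARTNIK RIGIDITY AT KERR COLLARS (card K1+K3). For every margin χ < 1,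
mass window m₀, hole bound N₀, target (k, ε): there is k' such that for every geometry bound Λ < ∞
there are δ, γ > 0 with: whenever an MGHD 𝒟 of admissible vacuum data contains a hypersurface S
which is a (Λ, k')-near-Kerr leaf with N ≤ N₀ holes (Mᵢ, aᵢ), m₀ ≤ Mᵢ ≤ 1/m₀, |aᵢ| ≤ χMᵢ (bounded
geometry, not smallness), a point p ∈ S, and N pairwise disjoint thick collar charts Φᵢ (Kerr-star
charts on {Mᵢ < r ≤ 3Mᵢ} × (−1,1), smooth open embeddings, δ-close in C^{k'} to Kerr(Mᵢ,aᵢ) on the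
collar slab, collar slabs ⊆ S) such that the core C = {p} ∪ ⋃ collars has a cut Bondi energy and
Bondi–Bartnik gap ≤ γ — then some (ε, k)-near-Kerr leaf S′ with the same (N, M, a) lies in J⁺(S).
Exact case (δ = γ = 0, N = 1): a slice realising the Bondi–Bartnik infimum of its own Kerr collar is
a slice of Kerr (minimiser ⇒ stationary vacuum ⇒ equal to Kerr on the strictly stationary shell ⇒
Kerr); N = 0: small Bondi mass at the cut of a point + bounded geometry ⇒ near-flat hyperboloid
(positive-mass stability at 𝓘⁺); N ≥ 2: no stationary competitor exists, the gap measures binding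
energy and closes only b -/
@[route_item "route-FinalStateConjecture-BartnikGapSettling", crux]
def BondiBartnikRigidity : Prop :=
  open Literature.Geometry.Lorentzian in ∀ (χ m₀ : ℝ) (N₀ k : ℕ) (ε : ENNReal), χ < 1 → 0 < m₀ → 0 < ε → ∃ k' : ℕ, ∀ Λ : ENNReal, Λ < ⊤ → ∃ (δ : ENNReal) (γ : ℝ), 0 < δ ∧ 0 < γ ∧ ∀ (X : Type) [TopologicalSpace X] [ChartedSpace E3 X] [IsManifold (𝓡 3) ((⊤ : ℕ∞) : WithTop ℕ∞) X] [T2Space X] [SecondCountableTopology X] [ConnectedSpace X], ∀ D ∈ admissibleVacuumData X, ∀ (𝒟 : VacuumCauchyDevelopment D) (N : ℕ) (M a : Fin N → ℝ) (S : Set 𝒟.carrier) (p : 𝒟.carrier) (mo' : Fin N → lorentzGroup × E4) (B' : Fin N → ModelBackground) (Φ : ∀ i, (B' i).domain → 𝒟.carrier), 𝒟.IsMaximal → N ≤ N₀ → (∀ i, m₀ ≤ M i ∧ M i ≤ m₀⁻¹ ∧ |a i| ≤ χ * M i) → 𝒟.toCauchyDevelopment.IsNearKerrLeaf k' Λ N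 M a S → p ∈ S → (∀ i, B' i = starBackground (mo' i).1 (mo' i).2 (M i) (a i) (fun x => Kerr.radius (a i) (poincareInv (mo' i).1 (mo' i).2 x))) → (∀ i, ContMDiffOn 𝓘(ℝ, E4) (𝓡 4) ((⊤ : ℕ∞) : WithTop ℕ∞) (Φ i) {x | -1 < (B' i).time x.1 ∧ (B' i).time x.1 < 1 ∧ (B' i).radius x.1 < 3 * M i + 1} ∧ Topology.IsOpenEmbedding ({x | -1 < (B' i).time x.1 ∧ (B' i).time x.1 < 1 ∧ (B' i).radius x.1 < 3 * M i + 1}.restrict (Φ i))) → (∀ i, 𝒟.toSpacetime.truncDeviationCk (B' i) (Φ i) k' (3 * M i) 0 ≤ δ) → (∀ i, Φ i '' (B' i).truncTimeSlab (3 * M i) 0 ⊆ S) → Pairwise (Function.onFun Disjoint fun i => Φ i '' (B' i).truncTimeSlab (3 * M i) 0) → (∃ m : ℝ, 𝒟.toCauchyDevelopment.HasCutBondiMass ({p} ∪ ⋃ i, Φ i '' (B' i).truncTimeSlab (3 * M i) 0) m) → (∀ (X' : Type) [TopologicalSpace X'] [ChartedSpace E3 X'] [IsManifold (𝓡 3)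 ((⊤ : ℕ∞) : WithTop ℕ∞) X'] [T2Space X'] [SecondCountableTopology X'] [ConnectedSpace X'], ∀ D' ∈ admissibleVacuumData X', ∀ (𝒟' : VacuumCauchyDevelopment D') (U : Set 𝒟.carrier) (φ : 𝒟.carrier → 𝒟'.carrier) (m' : ℝ), 𝒟'.IsMaximal → IsOpen U → ({p} ∪ ⋃ i, Φ i '' (B' i).truncTimeSlab (3 * M i) 0) ⊆ U → ContMDiffOn (𝓡 4) (𝓡 4) ((⊤ : ℕ∞) : WithTop ℕ∞) φ U → Topology.IsOpenEmbedding (U.restrict φ) → (∀ q ∈ U, pullbackBilin (I := 𝓡 4) (I' := 𝓡 4) φ 𝒟'.metric.val q = 𝒟.metric.val q) → (∀ q ∈ U, 𝒟'.timeOrientation.IsFutureDirected (mfderiv (𝓡 4) (𝓡 4) φ q (𝒟.timeOrientation.vectorField q))) → 𝒟'.toCauchyDevelopment.HasCutBondiMass (φ '' ({p} ∪ ⋃ i, Φ i '' (B' i).truncTimeSlab (3 * M i) 0)) m' → ∀ η : ℝ, 0 < η → ∃ m : ℝ, 𝒟.toCauchyDevelopment.HasCutBondiMass ({p} ∪ ⋃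 i, Φ i '' (B' i).truncTimeSlab (3 * M i) 0) m ∧ m ≤ m' + γ + η) → ∃ S' : Set 𝒟.carrier, 𝒟.toCauchyDevelopment.IsNearKerrLeaf k ε N M a S' ∧ S' ⊆ 𝒟.metric.causalFuture 𝒟.timeOrientation S

/-- item stmt-FinalStateConjecture-10808 · crux · rank 3 · open · by planner
why it might fail: Calibration needs β_B(thick Kerr collar)=M exactly (null Penrose inequality with angular momentum, non-axisymmetric extensions; open even at a=0) else settled Kerr keeps gap≥c>0; ∀-data form: eternal exterior reservoir; Λ-unbounded late hyperboloids (Burnett); Bondi mass at cuts needs regular scri.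
sources: arXiv:1504.04592, arXiv:1506.06400, HollandsWald2012, ChruscielJezierskiLeski2004, ChristodoulouKlainerman1993PMS41, HuangLee2020
[crux] GAP EXHAUSTION (card K2+K4, the dynamical input). For every admissible datum and every MGHD 𝒟
with complete 𝓘⁺ (sojourn form) satisfying the COLLAR MARGIN (some χ₁ < 1, k₁, δ₁ > 0, compact K₁:
every thick collar chart δ₁-close in C^{k₁} to Kerr(M₁,a₁) lying beyond J⁻(K₁) has |a₁| ≤ χ₁M₁):
there are N₀, m₀ > 0, χ < 1 such that for every k there is Λ < ∞ such that for every δ, γ > 0 and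
every compact K, 𝒟 contains a (Λ,k)-near-Kerr leaf S with J⁺(S) ∩ J⁻(K) = ∅, N ≤ N₀ holes with m₀ ≤
Mᵢ ≤ 1/m₀, |aᵢ| ≤ χMᵢ, a point p ∈ S and N pairwise disjoint thick collar charts δ-close in Cᵏ to
Kerr(Mᵢ,aᵢ) with collar slabs ⊆ S, such that the core {p} ∪ ⋃ collars has a cut Bondi energy and
Bondi–Bartnik gap ≤ γ. In words: late hyperboloidal slices have uniformly bounded geometry, finitely
many non-tiny apparent horizons with near-Kerr thick collars, and ALL the Bondi mass is eventually
attributable to the collars — nothing outside them could still be shed (radiation leaves, holes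
separate, no eternal reservoir). [difficulty: open-problem] -/
@[route_item "route-FinalStateConjecture-BartnikGapSettling", crux]
def GapExhaustion : Prop :=
  open Literature.Geometry.Lorentzian in ∀ (X : Type) [TopologicalSpace X] [ChartedSpace E3 X] [IsManifold (𝓡 3) ((⊤ : ℕ∞) : WithTop ℕ∞) X] [T2Space X] [SecondCountableTopology X] [ConnectedSpace X], ∀ D ∈ admissibleVacuumData X, ∀ 𝒟 : VacuumCauchyDevelopment D, 𝒟.IsMaximal → Summit.FinalStateConjecture.HasCompleteNullInfinity 𝒟.toCauchyDevelopment → (∃ (χ₁ : ℝ) (k₁ : ℕ) (δ₁ : ENNReal) (K₁ : Set 𝒟.carrier), χ₁ < 1 ∧ 0 < δ₁ ∧ IsCompact K₁ ∧ ∀ (M₁ a₁ : ℝ) (mo₁ : lorentzGroup × E4) (B₁ : ModelBackground) (Φ₁ : B₁.domain → 𝒟.carrier), 0 < M₁ → |a₁| ≤ M₁ → B₁ = starBackground mo₁.1 mo₁.2 M₁ a₁ (fun x => Kerr.radius a₁ (poincareInv mo₁.1 mo₁.2 x)) → ContMDiffOn 𝓘(ℝ, E4) (𝓡 4) ((⊤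 : ℕ∞) : WithTop ℕ∞) Φ₁ {x | -1 < B₁.time x.1 ∧ B₁.time x.1 < 1 ∧ B₁.radius x.1 < 3 * M₁ + 1} → Topology.IsOpenEmbedding ({x | -1 < B₁.time x.1 ∧ B₁.time x.1 < 1 ∧ B₁.radius x.1 < 3 * M₁ + 1}.restrict Φ₁) → 𝒟.toSpacetime.truncDeviationCk B₁ Φ₁ k₁ (3 * M₁) 0 ≤ δ₁ → Disjoint (Φ₁ '' B₁.truncTimeSlab (3 * M₁) 0) (𝒟.metric.causalPast 𝒟.timeOrientation K₁) → |a₁| ≤ χ₁ * M₁) → ∃ (N₀ : ℕ) (m₀ χ : ℝ), 0 < m₀ ∧ χ < 1 ∧ ∀ k : ℕ, ∃ Λ : ENNReal, Λ < ⊤ ∧ ∀ (δ : ENNReal) (γ : ℝ), 0 < δ → 0 < γ → ∀ K : Set 𝒟.carrier, IsCompact K → ∃ (N : ℕ) (M a : Fin N → ℝ) (S : Set 𝒟.carrier) (p : 𝒟.carrier) (mo' : Fin N → lorentzGroup × E4) (B' : Fin N → ModelBackground) (Φ : ∀ i, (B' i).domain → 𝒟.carrier), N ≤ N₀ ∧ (∀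 i, m₀ ≤ M i ∧ M i ≤ m₀⁻¹ ∧ |a i| ≤ χ * M i) ∧ 𝒟.toCauchyDevelopment.IsNearKerrLeaf k Λ N M a S ∧ p ∈ S ∧ Disjoint (𝒟.metric.causalFuture 𝒟.timeOrientation S) (𝒟.metric.causalPast 𝒟.timeOrientation K) ∧ (∀ i, B' i = starBackground (mo' i).1 (mo' i).2 (M i) (a i) (fun x => Kerr.radius (a i) (poincareInv (mo' i).1 (mo' i).2 x))) ∧ (∀ i, ContMDiffOn 𝓘(ℝ, E4) (𝓡 4) ((⊤ : ℕ∞) : WithTop ℕ∞) (Φ i) {x | -1 < (B' i).time x.1 ∧ (B' i).time x.1 < 1 ∧ (B' i).radius x.1 < 3 * M i + 1} ∧ Topology.IsOpenEmbedding ({x | -1 < (B' i).time x.1 ∧ (B' i).time x.1 < 1 ∧ (B' i).radius x.1 < 3 * M i + 1}.restrict (Φ i))) ∧ (∀ i, 𝒟.toSpacetime.truncDeviationCk (B' i) (Φ i) k (3 * M i) 0 ≤ δ) ∧ (∀ i, Φ i '' (B' i).truncTimeSlab (3 * M i) 0 ⊆ S) ∧ Pairwise (Function.onFun Disjoint fun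 i => Φ i '' (B' i).truncTimeSlab (3 * M i) 0) ∧ (∃ m : ℝ, 𝒟.toCauchyDevelopment.HasCutBondiMass ({p} ∪ ⋃ i, Φ i '' (B' i).truncTimeSlab (3 * M i) 0) m) ∧ (∀ (X' : Type) [TopologicalSpace X'] [ChartedSpace E3 X'] [IsManifold (𝓡 3) ((⊤ : ℕ∞) : WithTop ℕ∞) X'] [T2Space X'] [SecondCountableTopology X'] [ConnectedSpace X'], ∀ D' ∈ admissibleVacuumData X', ∀ (𝒟' : VacuumCauchyDevelopment D') (U : Set 𝒟.carrier) (φ : 𝒟.carrier → 𝒟'.carrier) (m' : ℝ), 𝒟'.IsMaximal → IsOpen U → ({p} ∪ ⋃ i, Φ i '' (B' i).truncTimeSlab (3 * M i) 0) ⊆ U → ContMDiffOn (𝓡 4) (𝓡 4) ((⊤ : ℕ∞) : WithTop ℕ∞) φ U → Topology.IsOpenEmbedding (U.restrict φ) → (∀ q ∈ U, pullbackBilin (I := 𝓡 4) (I' := 𝓡 4) φ 𝒟'.metric.val q = 𝒟.metric.val q) → (∀ q ∈ U, 𝒟'.timeOrientation.IsFutureDirected (mfderiv (𝓡 4) (𝓡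 4) φ q (𝒟.timeOrientation.vectorField q))) → 𝒟'.toCauchyDevelopment.HasCutBondiMass (φ '' ({p} ∪ ⋃ i, Φ i '' (B' i).truncTimeSlab (3 * M i) 0)) m' → ∀ η : ℝ, 0 < η → ∃ m : ℝ, 𝒟.toCauchyDevelopment.HasCutBondiMass ({p} ∪ ⋃ i, Φ i '' (B' i).truncTimeSlab (3 * M i) 0) m ∧ m ≤ m' + γ + η)

/-- item stmt-FinalStateConjecture-17328 · crux · rank 4 · open · by planner
why it might fail: quiet≠settled for N≥2 (no velocities: binaries, late plunges); unweighted Cᵏ leaves vs weighted decay of stability proofs; only |a|≪M known (GKS); T2 adds RaysStayInClosure — interior content (no future-complete null ray from Σ inside the hole) that exterior leaves do not control.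
sources: KlainermanSzeftel2023, DafermosHolzegelRodnianskiTaylor2021, DafermosRodnianski2008, arXiv:2205.14808, arXiv:2104.11857, arXiv:1710.01722
[crux] SETTLED CAPTURE (re-typed T2 form of the sibling leaf-capture crux Capture,
stmt-FinalStateConjecture-10115: hypotheses verbatim, conclusion = the re-typed summit clause
verbatim). Let 𝒟 be a maximal vacuum Cauchy development of an admissible datum with complete 𝓘⁺. If
𝒟 has NEAR-SUBEXTREMAL-KERR LEAVES — N₀, m₀ > 0, χ < 1, k₁, ε₁ > 0 such that for every k, every ε >
0 and every compact K there is an (ε,k)-near-Kerr leaf S disjoint from J⁻(K) with N ≤ N₀ holes of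
masses in [m₀, 1/m₀], which moreover has |aᵢ| ≤ χ·Mᵢ for all i whenever k ≥ k₁ and ε ≤ ε₁ — then 𝒟
settles down EXACTLY as the T2 Statement demands: there are O ⊆ 𝒟 and a C² FinalStateDecomposition d
of O with Kerr.IsSubextremal (d.mass i) (d.spin i) for all i, O = exteriorOf 𝒟 d.charted,
RaysStayInClosure 𝒟 O (every future-complete normalised null ray from Σ stays in closure O),
HasExhaustiveCharts d (honest near-zone radii Rᵢ ≥ max(r₊,0)+1, Rᵢ → ∞, C² convergence out to Rᵢ,
every point of O outside the certified late region causally below the certified slab) and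
IsFutureOriented d (orthochronous motions; transported Kerr timeVector / ∂₀ push-forwards eventually
future-directed). For N ≤ 1 this is the sub-extremal -/
@[route_item "route-FinalStateConjecture-BartnikGapSettling", crux]
def SettledCapture : Prop :=
  open Literature.Geometry.Lorentzian in ∀ (X : Type) [TopologicalSpace X] [ChartedSpace E3 X] [IsManifold (𝓡 3) ((⊤ : ℕ∞) : WithTop ℕ∞) X] [T2Space X] [SecondCountableTopology X] [ConnectedSpace X], ∀ D ∈ admissibleVacuumData X, ∀ 𝒟 : VacuumCauchyDevelopment D, 𝒟.IsMaximal → Summit.FinalStateConjecture.HasCompleteNullInfinity 𝒟.toCauchyDevelopment → (∃ (N₀ : ℕ) (m₀ χ : ℝ) (k₁ : ℕ) (ε₁ : ENNReal), 0 < m₀ ∧ χ < 1 ∧ 0 < ε₁ ∧ ∀ (k : ℕ) (ε : ENNReal), 0 < ε → ∀ K : Set 𝒟.carrier, IsCompact K → ∃ (N : ℕ) (M a : Fin N → ℝ) (S : Set 𝒟.carrier), N ≤ N₀ ∧ (∀ i, m₀ ≤ M i ∧ M i ≤ m₀⁻¹) ∧ Disjoint S (𝒟.metric.causalPast 𝒟.timeOrientation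 K) ∧ (∃ (R ρ : Fin N → ℝ) (mo : Fin N → lorentzGroup × E4) (r : Fin N → E4 → ℝ) (B : Fin N → ModelBackground) (U₀ : TopologicalSpace.Opens E4) (B₀ : ModelBackground) (Ψ : ∀ i, (B i).domain → 𝒟.carrier) (Ψ₀ : B₀.domain → 𝒟.carrier) (L W : ∀ i, Set (B i).domain) (L₀ W₀ : Set B₀.domain), (∀ i, r i = fun x => Kerr.radius (a i) (poincareInv (mo i).1 (mo i).2 x)) ∧ (∀ i, B i = (⟨⟨poincareInv (mo i).1 (mo i).2 ⁻¹' (Kerr.region (a i) (M i) : Set E4), (Kerr.region (a i) (M i)).isOpen.preimage (continuous_poincareInv (mo i).1 (mo i).2)⟩, boostedKerrBilin (mo i).1 (mo i).2 (M i) (a i), fun x => poincareInv (mo i).1 (mo i).2 x 0, r i⟩ : ModelBackground)) ∧ B₀ = (⟨U₀, fun _ => Minkowski.bilin, fun x => x 0 - Real.sqrt (1 + E4.spatialNorm x ^ 2), E4.spatialNorm⟩ : ModelBackground) ∧ (∀ i, L i = {x | -1 < (B i).time x.1 ∧ (B i).time x.1 < 1 ∧ (B i).radius x.1 < R i + 1}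 ∧ W i = {x | 0 < (B i).time x.1 ∧ (B i).time x.1 < 1 ∧ (B i).radius x.1 ≤ R i}) ∧ L₀ = {x | -1 < B₀.time x.1 ∧ B₀.time x.1 < 1} ∧ W₀ = {x | 0 < B₀.time x.1 ∧ B₀.time x.1 < 1} ∧ (∀ i, 0 < M i ∧ |a i| ≤ M i ∧ 0 < ρ i ∧ ρ i < R i) ∧ {x : E4 | -1 < x 0 - Real.sqrt (1 + E4.spatialNorm x ^ 2) ∧ ∀ i, ρ i < r i x} ⊆ (U₀ : Set E4) ∧ (∀ i, ContMDiffOn 𝓘(ℝ, E4) (𝓡 4) ((⊤ : ℕ∞) : WithTop ℕ∞) (Ψ i) (L i) ∧ Topology.IsOpenEmbedding ((L i).restrict (Ψ i)) ∧ Ψ i '' L i ⊆ 𝒟.metric.causalFuture 𝒟.timeOrientation (Set.range 𝒟.embed)) ∧ ContMDiffOn 𝓘(ℝ, E4) (𝓡 4) ((⊤ : ℕ∞) : WithTop ℕ∞) Ψ₀ L₀ ∧ Topology.IsOpenEmbedding (L₀.restrict Ψ₀) ∧ Ψ₀ '' L₀ ⊆ 𝒟.metric.causalFuture 𝒟.timeOrientation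 (Set.range 𝒟.embed) ∧ (∀ i, 𝒟.toSpacetime.truncDeviationCk (B i) (Ψ i) k (R i) 0 ≤ ε) ∧ 𝒟.toSpacetime.deviationCk B₀ Ψ₀ k 0 ≤ ε ∧ Pairwise (Function.onFun Disjoint fun i => Ψ i '' {x | x ∈ L i ∧ (B i).radius x.1 ≤ R i}) ∧ (∀ i, Ψ i '' {x | (B i).time x.1 = 0 ∧ ρ i < (B i).radius x.1 ∧ (B i).radius x.1 ≤ R i} ⊆ Ψ₀ '' L₀) ∧ (∀ i, Ψ₀ '' {x | B₀.time x.1 = 0 ∧ ρ i < r i x.1 ∧ r i x.1 < R i} ⊆ Ψ i '' L i) ∧ S = Ψ₀ '' B₀.timeSlab 0 ∪ ⋃ i, Ψ i '' (B i).truncTimeSlab (R i) 0 ∧ Ψ₀ '' W₀ ∪ ⋃ i, Ψ i '' W i ⊆ 𝒟.metric.chronologicalFuture 𝒟.timeOrientation S ∧ Summit.FinalStateConjecture.exteriorOf 𝒟.toCauchyDevelopment (Ψ₀ '' W₀ ∪ ⋃ i, Ψ i '' W i) \ (Ψ₀ '' W₀ ∪ ⋃ i, Ψ i '' W i) ⊆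 𝒟.metric.causalPast 𝒟.timeOrientation S) ∧ (k₁ ≤ k → ε ≤ ε₁ → ∀ i, |a i| ≤ χ * M i)) → (∃ (O : Set 𝒟.carrier) (d : FinalStateDecomposition 𝒟.toSpacetime O 2), (∀ i, Kerr.IsSubextremal (d.mass i) (d.spin i)) ∧ O = Summit.FinalStateConjecture.exteriorOf 𝒟.toCauchyDevelopment d.charted ∧ Summit.FinalStateConjecture.RaysStayInClosure 𝒟.toCauchyDevelopment O ∧ Summit.FinalStateConjecture.HasExhaustiveCharts d ∧ Summit.FinalStateConjecture.IsFutureOriented d)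

/-- item stmt-FinalStateConjecture-17329 · crux · rank 5 · open · by planner
why it might fail: contains weak cosmic censorship outright; extremal horizons form on the collapse threshold (Kehle–Unger), so the margin is at best generic; TAME witness curves (fixed end, wDist→0, immersed) through every bad datum — even their non-vacuity needs unproved lemmas (MissingL3/L4).
sources: Christodoulou1999, KehleUnger2025, arXiv:2402.10190, Aretakis2015, arXiv:1710.01722, arXiv:0811.0354
[crux] TAME GENERIC CENSORSHIP + COLLAR MARGIN, ONE generic statement in the re-typed genericity of
the T2 summit (InitialDataSet.IsTameChristodoulouGeneric … 1: through every exceptional admissible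
datum passes an injective one-parameter family of admissible data, tame on ONE fixed asymptotically
flat end — jointly smooth, continuous mass M(c), continuous at c = 0 in the weighted C²₋₁ × C¹₋₂
distance AFEnd.wDist — and immersed at c = 0, all of whose other members are good): for every
connected Hausdorff second-countable 3-manifold X, tame-generically in the admissible class, EVERY
MGHD of the datum has complete future null infinity (sojourn form) AND the collar margin of
GapExhaustion (some χ₁ < 1, k₁, δ₁ > 0, compact K₁: every thick collar chart δ₁-close in C^{k₁} to
Kerr(M₁,a₁) beyond J⁻(K₁) has |a₁| ≤ χ₁M₁) — weak cosmic censorship in the audited typing plus the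
generic third law of black-hole mechanics in near-horizon form; tame genericity is not closed under
∧, hence one statement. No settling claim. Replaces the pre-re-type GenericCensorshipCollarMargin
(same property under the topology-free IsChristodoulouGeneric, which admitted burial witnesses and
which the summit no long -/
@[route_item "route-FinalStateConjecture-BartnikGapSettling", crux]
def TameCensorshipCollarMargin : Prop :=
  open Literature.Geometry.Lorentzian in ∀ (X : Type) [TopologicalSpace X] [ChartedSpace E3 X] [IsManifold (𝓡 3) ((⊤ : ℕ∞) : WithTop ℕ∞) X] [T2Space X] [SecondCountableTopology X] [ConnectedSpace X], InitialDataSet.IsTameChristodoulouGeneric (admissibleVacuumData X) (fun D => ∀ 𝒟 : VacuumCauchyDevelopment D, 𝒟.IsMaximal → Summit.FinalStateConjecture.HasCompleteNullInfinity 𝒟.toCauchyDevelopment ∧ (∃ (χ₁ : ℝ) (k₁ : ℕ) (δ₁ : ENNReal) (K₁ : Set 𝒟.carrier), χ₁ < 1 ∧ 0 < δ₁ ∧ IsCompact K₁ ∧ ∀ (M₁ a₁ : ℝ) (mo₁ : lorentzGroup × E4) (B₁ : ModelBackground) (Φ₁ : B₁.domain → 𝒟.carrier), 0 < M₁ → |a₁|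 ≤ M₁ → B₁ = starBackground mo₁.1 mo₁.2 M₁ a₁ (fun x => Kerr.radius a₁ (poincareInv mo₁.1 mo₁.2 x)) → ContMDiffOn 𝓘(ℝ, E4) (𝓡 4) ((⊤ : ℕ∞) : WithTop ℕ∞) Φ₁ {x | -1 < B₁.time x.1 ∧ B₁.time x.1 < 1 ∧ B₁.radius x.1 < 3 * M₁ + 1} → Topology.IsOpenEmbedding ({x | -1 < B₁.time x.1 ∧ B₁.time x.1 < 1 ∧ B₁.radius x.1 < 3 * M₁ + 1}.restrict Φ₁) → 𝒟.toSpacetime.truncDeviationCk B₁ Φ₁ k₁ (3 * M₁) 0 ≤ δ₁ → Disjoint (Φ₁ '' B₁.truncTimeSlab (3 * M₁) 0) (𝒟.metric.causalPast 𝒟.timeOrientation K₁) → |a₁| ≤ χ₁ * M₁)) 1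

/-- item stmt-FinalStateConjecture-9937 · crux · rank 9 · open · by planner
why it might fail: Known in print (CBG 1969 Thm 3) but an unproved XL tree fact (choquetBruhat_geroch_exists_mghd_cauchy) typed over the REPAIRED prelude: IsMaximal asks EVERY typed VacuumCauchyDevelopment.{0} of D to embed into one 𝒟; a rogue typed development falsifies it (1st render: VacuumDevelopment.isEmpty).
sources: ChoquetBruhatGeroch1969CMP, Sbierski2016AHP, Ringstrom2009, Literature.Geometry.Lorentzian.choquetBruhat_geroch_exists_mghd_cauchy.forall_mem_admissibleVacuumData, Literature.Geometry.Lorentzian.CauchyProblemExistenceDefect, Literature.Geometry.Lorentzian.VacuumDevelopment.isEmpty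
[support] every admissible datum has a maximal globally hyperbolic vacuum development, stated over
the repaired structure `VacuumCauchyDevelopment` (the corrected form of the deprecated
`choquetBruhat_geroch_exists_mghd`, recorded in `CauchyProblemExistenceDefect`);
Choquet-Bruhat–Geroch 1969 Thm. 3, Sbierski 2016 Thm. 2.6. Known theorem; large formalisation;
shared by every route of this summit. [difficulty: XL] -/
@[route_item "route-FinalStateConjecture-BartnikGapSettling", crux]
def MGHDExists : Prop :=
  ∀ (X : Type) [TopologicalSpace X] [ChartedSpace Literature.Geometry.Lorentzian.E3 X] [IsManifold (𝓡 3) ((⊤ : ℕ∞) : WithTop ℕ∞) X] [T2Space X] [SecondCountableTopology X] [ConnectedSpace X], ∀ D ∈ Literature.Geometry.Lorentzian.admissibleVacuumData X, ∃ 𝒟 : Literature.Geometry.Lorentzian.VacuumCauchyDevelopment D, 𝒟.IsMaximal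

/-- item stmt-FinalStateConjecture-10810 · support · rank 9 · closed · proved by Summit.FinalStateConjecture.FinalStateConjecture.Theorems.selfCompetitor_proof (prover) · by planner
sources: Bartnik1989, ChristodoulouKlainerman1993PMS41
[support] ANTI-VACUITY OF THE COMPETITOR CLASS (provable now; proved in the planner's
sk/IffCheck.lean as `selfCompetitor_holds` with U = univ, φ = id): for every vacuum Cauchy
development 𝒟, core C and real m with HasCutBondiMass 𝒟 C m, the identity is an admissible
competitor embedding — an open U ⊇ C and φ smooth on U, an open embedding of U, isometric and
future-directed on U, with HasCutBondiMass 𝒟 (φ '' C) m. Hence the development competes for its own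
cores whenever the cut has a Bondi energy: the Bondi–Bartnik gap is ≥ 0 and the gap clause of the
cruxes has content. [difficulty: provable-now] -/
@[route_item "route-FinalStateConjecture-BartnikGapSettling"]
def SelfCompetitor : Prop :=
  open Literature.Geometry.Lorentzian in ∀ (X : Type) [TopologicalSpace X] [ChartedSpace E3 X] [IsManifold (𝓡 3) ((⊤ : ℕ∞) : WithTop ℕ∞) X] [T2Space X] [SecondCountableTopology X] [ConnectedSpace X], ∀ (D : InitialDataSet (𝓡 3) X) (𝒟 : VacuumCauchyDevelopment D) (C : Set 𝒟.carrier) (m : ℝ), 𝒟.toCauchyDevelopment.HasCutBondiMass C m → ∃ (U : Set 𝒟.carrier) (φ : 𝒟.carrier → 𝒟.carrier), IsOpen U ∧ C ⊆ U ∧ ContMDiffOn (𝓡 4) (𝓡 4) ((⊤ : ℕ∞) : WithTop ℕ∞) φ U ∧ Topology.IsOpenEmbedding (U.restrict φ) ∧ (∀ q ∈ U, pullbackBilin (I := 𝓡 4) (I' := 𝓡 4) φ 𝒟.metric.val q = 𝒟.metric.val q) ∧ (∀ q ∈ U, 𝒟.timeOrientation.IsFutureDirected (mfderiv (𝓡 4)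 (𝓡 4) φ q (𝒟.timeOrientation.vectorField q))) ∧ 𝒟.toCauchyDevelopment.HasCutBondiMass (φ '' C) m

/-- `SelfCompetitor` holds: proved by `Summit.FinalStateConjecture.FinalStateConjecture.Theorems.selfCompetitor_proof`. -/
theorem SelfCompetitor_holds : SelfCompetitor := _root_.Summit.FinalStateConjecture.FinalStateConjecture.Theorems.selfCompetitor_proof

-- earlier Assembly (stmt-FinalStateConjecture-10811, replaced 2026-08-16T23:15:51Z -> stmt-FinalStateConjecture-17327): moot by None — BondiBartnikRigidity → GapExhaustion → Capture → GenericCensorshipCollarMargin → MGHDExists → SelfCompetitor → FinalStateConjecture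
-- earlier Assembly (stmt-FinalStateConjecture-17327, replaced 2026-08-16T23:28:55Z -> stmt-FinalStateConjecture-17714): retired by None — BondiBartnikRigidity → GapExhaustion → SettledCapture → TameCensorshipCollarMargin → MGHDExists → SelfCompetitor → FinalStateConjecture
/-- item stmt-FinalStateConjecture-17714 · assembly · rank 1 · closed · proved by Summit.FinalStateConjecture.FinalStateConjecture.Theorems.BartnikGapSettling.assemblyT2_proof @ 8234b3ac4fb9 (prover) · by planner
sources: Christodoulou1999, arXiv:1710.01722
[assembly] BondiBartnikRigidity → GapExhaustion → SettledCapture → TameCensorshipCollarMargin →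
MGHDExists → FinalStateConjecture (the root-level sub-problem Statement, re-typed T2 2026-08-16) —
literally the type of the route's sorry-free CRUX-ONLY deciding theorem `closes` (D-0027 §2.1; human
ruling 2026-08-16: every binder a crux item — MGHDExists re-badged crux, the proved support
SelfCompetitor no longer a binder). Provable outright from `closes`; kept only because the assembly
item cannot be dropped. -/
@[route_item "route-FinalStateConjecture-BartnikGapSettling"]
def Assembly : Prop :=
  BondiBartnikRigidity → GapExhaustion → SettledCapture → TameCensorshipCollarMargin → MGHDExists → FinalStateConjecture

-- `Assembly` holds: proved by `Summit.FinalStateConjecture.FinalStateConjecture.Theorems.BartnikGapSettling.assemblyT2_proof` @ 8234b3ac4fb9 (its module imports this route file, so no `_holds` link can be stated here).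

/-! D-0027 §2.1 — DECIDING THEOREM (planner-authored via `route open/edit --closes-file`; by planner-rbadge-FinalStateConjecture-BartnikGap-43114f76-0 2026-08-16T23:28:55Z):
its hypotheses are this route's items and its conclusion the sub-problem Statement (glue_lint), and it elaborates with this file. -/

/- D-0027 §2.1 deciding theorem for route BartnikGapSettling, CRUX-ONLY form (human ruling
   2026-08-16; route-repair 2026-08-16, glue.non-crux-hypothesis): the hypotheses are exactly the
   route's five CRUX items — BondiBartnikRigidity, GapExhaustion, SettledCapture,
   TameCensorshipCollarMargin and MGHDExists (the summit's shared anti-vacuity item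
   stmt-FinalStateConjecture-9937, re-badged crux on this route: known in print, CBG 1969 Thm 3,
   but unproved in the tree and typing-exposed through `IsMaximal`). The proved support
   SelfCompetitor is no longer a binder (it was unused; its `_holds` lemma stands in the file).
   Proof: TAME Christodoulou genericity (`IsTameChristodoulouGeneric`, one fixed end) is monotone
   under pointwise implication on the admissible class — witness family, end, tameness, immersion
   and injectivity kept, only the escape clause weakened; pointwise, MGHDExists gives the
   development, TameCensorshipCollarMargin gives complete 𝓘⁺ and the collar margin, GapExhaustion
   (fed the margin) gives late bounded-geometry leaves through δ-near-Kerr collars with γ-small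
   Bondi–Bartnik gap, BondiBartnikRigidity turns each into an (ε,k)-near-Kerr leaf to its causal
   future (hence still beyond J⁻(K), `Disjoint.mono_left`), and SettledCapture settles the
   development with the re-typed T2 conclusion — sub-extremal holes, O = exteriorOf,
   RaysStayInClosure, HasExhaustiveCharts (honest radii), IsFutureOriented.
   Axioms: propext, Classical.choice, Quot.sound. -/
@[closes "route-FinalStateConjecture-BartnikGapSettling"] theorem closes : BondiBartnikRigidity → GapExhaustion → SettledCapture → TameCensorshipCollarMargin →
    MGHDExists → FinalStateConjecture := by
  intro h₁ h₂ h₃ h₄ h₅ X _ _ _ _ _ _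
  have mono : ∀ {P Q : Literature.Geometry.Lorentzian.InitialDataSet (𝓡 3) X → Prop},
      Literature.Geometry.Lorentzian.InitialDataSet.IsTameChristodoulouGeneric
          (Literature.Geometry.Lorentzian.admissibleVacuumData X) P 1 →
        (∀ D ∈ Literature.Geometry.Lorentzian.admissibleVacuumData X, P D → Q D) →
          Literature.Geometry.Lorentzian.InitialDataSet.IsTameChristodoulouGeneric
            (Literature.Geometry.Lorentzian.admissibleVacuumData X) Q 1 := by
    intro P Q h hPQ d hd
    obtain ⟨e, F, hT, hI, h0, hinj, hDF, hE⟩ := h d ⟨hd.1, fun hP => hd.2 (hPQ d hd.1 hP)⟩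
    exact ⟨e, F, hT, hI, h0, hinj, hDF,
      fun c hc hc' => hE c hc ⟨hc'.1, fun hP => hc'.2 (hPQ _ hc'.1 hP)⟩⟩
  refine mono (h₄ X) ?_
  intro D hD hP
  refine ⟨h₅ X D hD, fun 𝒟 hmax => ?_⟩
  obtain ⟨hCNI, hCM⟩ := hP 𝒟 hmax
  refine ⟨hCNI, h₃ X D hD 𝒟 hmax hCNI ?_⟩
  obtain ⟨N₀, m₀, χ, hm₀, hχ, H2⟩ := h₂ X D hD 𝒟 hmax hCNI hCM
  refine ⟨N₀, m₀, χ, 0, ⊤, hm₀, hχ, ENNReal.zero_lt_top, fun k ε hε K hK => ?_⟩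
  obtain ⟨k', H1⟩ := h₁ χ m₀ N₀ k ε hχ hm₀ hε
  obtain ⟨Λ, hΛ, H2'⟩ := H2 k'
  obtain ⟨δ, γ, hδ, hγ, H1'⟩ := H1 Λ hΛ
  obtain ⟨N, M, a, S, p, mo', B', Φ, hN, hwin, hleaf, hp, hlate, c1, c2, c3, c4, c5, c6, c7⟩ :=
    H2' δ γ hδ hγ K hK
  obtain ⟨S', hleaf', hS'⟩ :=
    H1' X D hD 𝒟 N M a S p mo' B' Φ hmax hN hwin hleaf hp c1 c2 c3 c4 c5 c6 c7
  refine ⟨N, M, a, S', hN, fun i => ⟨(hwin i).1, (hwin i).2.1⟩, Disjoint.mono_left hS' hlate, ?_,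
    fun _ _ i => (hwin i).2.2⟩
  exact hleaf'

end Summit.FinalStateConjecture.FinalStateConjecture.Theses.BartnikGapSettling
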